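import Summits.HodgeConjecture.HodgeConjecture.Theses.NikulinTwinTransport
import Summits.HodgeConjecture.HodgeConjecture.Theses.AnchorTransport

/-!
# D10 glue (PREPARED, NOT PROPOSED) — `NikulinTwinTransport.SectorComplement` from AnchorTransport's two open cruxes

Strategist seat planner-cstrat-stmt-HodgeConjecture-13684-p1-0, 2026-08-17 (STRATEGY-CENSUS Part p1 §D10).
Intended target if the human/tenure opens the door: `Theorems/NikulinTwinTransportSectorComplementAnchorSplit.lean`
`--supports stmt-HodgeConjecture-13684`, then `route edit --split SectorComplement --into D10-children.json --glue-by
Summit.HodgeConjecture.HodgeConjecture.Theorems.nikulinTwinTransport_sectorComplement_of_variationalHodge_of_anchorExistence`.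
The children are VERBATIM `AnchorTransport.VariationalHodge` (stmt-1076) and `AnchorTransport.AnchorExistence` (stmt-1077), so the
split dedups onto those items. The proof is AnchorTransport's deciding theorem with its two PROVED supports
(`IsoInvariance_holds`, `HodgeModels_holds`); the sector hypothesis is discarded. Blocked today by the route's row cap.
-/

set_option linter.dupNamespace false

namespace Summit.HodgeConjecture.HodgeConjecture.Theorems

open Summit.HodgeConjecture.HodgeConjecture.Theses

/-- `VariationalHodge → AnchorExistence → (SquareHodgeOfSqrtTwo → HodgeConjecture)`: the complement frame of
NikulinTwinTransport is discharged by the anchor programme (Σ unused). [folklore] -/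
theorem nikulinTwinTransport_sectorComplement_of_variationalHodge_of_anchorExistence
    (hV : AnchorTransport.VariationalHodge) (hAn : AnchorTransport.AnchorExistence) :
    NikulinTwinTransport.SectorComplement :=
  fun _ ↦ AnchorTransport.closes hV hAn AnchorTransport.IsoInvariance_holds AnchorTransport.HodgeModels_holds

end Summit.HodgeConjecture.HodgeConjecture.Theorems
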